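import Summits.QuantumFields.BalabanUV.Beta.FP.SliceKcovStraight
import Summits.QuantumFields.BalabanUV.Beta.FP.GhostBiTableReflection
import Summits.QuantumFields.BalabanUV.Beta.FP.LegShiftDictionary

/-!
# `BalabanUV.Beta.FP.StraightPolarizationKcov` — road «FP», binder row D1, sub-row **H2-ASM-5a (Kcov)**, module R14: THE (Kcov) LETTER OF THE STRAIGHT BF POLARIZATION
# IN ONE STATEMENT — gluon sector at the swapped perfect leg (R13, displayed `S∞`-share laws) and ghost sector at the explicit cross contact (leaf-01
# `GhostBiTableReflection`, unconditional), glued by linearity of the reflection predicate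

HONEST DEPENDENCY (page 1, mandatory): continuum YM on T⁴ ⇐ BetaPertH ∧ nine spine estimates (0/9 proved); BetaPertH ⇐ (D1) ∧ (D4) ∧ CAP+tail;
G-an2-4 gates asym, D1 and NE2/3/4.  HONEST FRAMING (cell contract, verbatim): «discharging `BetaPertH` makes Bałaban's UV stability UNCONDITIONAL —
a real constructive-QFT result; it is NOT the continuum limit and NOT the Clay problem.»  THIS MODULE DISCHARGES NOTHING of the wall: a `lincomb` of two tree theorems
(R13 `SliceKcovStraight.axisReflectionCovariant_flip_hessKer_sliceTotal_straight`, leaf-01 `GhostBiTableReflection.axisReflectionCovariant_flip_hessKer_ghostX`) BY NAME;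
the `S∞`-share's laws and letters and the remainder's letters stay DISPLAYED; 0 def, 0 `def … : Prop`, nothing cited, 0 sorry; 0 estimates; 0∕4 row-D1 binders;
NOT `hKcov` of `PiBF` AS TYPED (that is the owner's dictionary step, R-FP-42: `PiBF wg wgh (Ψ·V) (Ψ·W) v w` = the straight polarization below), NOT H2V-4, NOT (ASYMP),
NOT D1, NOT BetaPertH, NOT continuum, NOT Clay.

ABSOLUTE RULE (cell charter, verbatim): «No internally-minted statement may enter as a cited fact. Every hypothesis is either kernel-proved in this package or a
verbatim quotation of a PUBLISHED theorem with page reference. The manuscript(s) under audit are NOT citable for their own disputed steps — they are the thing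
under adjudication; programme-internal (2001/route/tribunal) claims are never citable.»

CONTENT: **`axisReflectionCovariant_flipK_straightBF (wg wgh cV c : ℝ) (N L : ℕ)`** — for the TOTAL gluon data `(S₃ + sliceA 3, S₄ + sliceW 3)` with the DISPLAYED laws `hS₃`∕`hS₄`
(R10's shapes against `MFˢˢ − ddKer`), `Loc` + unit covariance of the `S∞` share, `Loc` + tadpole-nullity of the remainder, and the explicit ghost data `(cV • ghCur, diagExt (c • ghX))`:
`AxisReflectionCovariant (flipK (fun μ ν z => wg * hessKer Pkerˢˢ (S₃ + sliceA 3) (S₄ + sliceW 3) μ ν z − wgh * hessKer G0ker (cV • ghCur) (diagExt (c • ghX)) μ ν z))`.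
§2 **`axisReflectionCovariant_flipK_PiBF_legShift`** — THE SAME LETTER AT `PiBF` AS TYPED OVER THE RELABELLED GLUON DATA (R-FP-42's dictionary, owner d1-p3-g11
`LegShiftDictionary.PiBF_legShift` p261973 ✓): for the leg-shift relabelling `Ψ` (`x ↦ x − e_α` on field legs, signs `+1`) and uniform `BiLoc` letters of the total data,
`AxisReflectionCovariant (flipK (PiBF wg wgh (Ψ·(S₃ + sliceA 3)) (Ψ·(S₄ + sliceW 3)) (cV • ghCur) (diagExt (c • ghX))))` — the `hKcov` binder of the literal ENDs for these data.
Provenance: D1 formalisation swarm seat b2b-balaban-beta-d1-formalise-leaf-02 gen 11 (road FP engine lineage), 2026-08-21 (OFFER O-d1leaf02g11-2).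
-/

noncomputable section

namespace Summit.QuantumFields.BalabanUV.Beta.FP.StraightPolarizationKcov

open Literature.MathematicalPhysics.QuantumFieldTheory.Balaban1983to89
open Literature.MathematicalPhysics.QuantumFieldTheory.Balaban1983to89.Beta
open PolarizationSign (reflSign AxisReflectionCovariant)
open ExpKernelCalculus (MKer Site tadpole hessKer shiftK)
open OneStepKernelFamily (flipK flipK_apply)
open KernelReflection (refK)
open ResolventReflection (bref Φ)
open OneStepResolventKernel (Fib)
open Summit.QuantumFields.BalabanUV.Beta.TameKernelCalculus (Loc)
open Summit.QuantumFields.BalabanUV.Beta.ChartConjugation (conjV conjW)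
open Summit.QuantumFields.BalabanUV.Beta.BorderedHessian (diagK ctGen)
open Summit.QuantumFields.BalabanUV.Beta.D1BFx.GhostStencil (ghCur)
open Summit.QuantumFields.BalabanUV.Beta.D1BFx.ReducedKernelSandwichBlock (diagExt)
open Summit.QuantumFields.BalabanUV.Beta.D1BFx.GhostStencilReflection (ghX)
open Summit.QuantumFields.BalabanUV.Beta.FP.SliceVertex (sliceA)
open Summit.QuantumFields.BalabanUV.Beta.FP.SliceBiStencil (sliceW)
open Summit.QuantumFields.BalabanUV.Beta.FP.SliceGaugeLaw (ddKer)
open Summit.QuantumFields.BalabanUV.Beta.FP.PerfectPolarization (Pker G0ker)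
open Summit.QuantumFields.BalabanUV.Beta.FP.PerfectPropagatorInverse (MF)
open Summit.QuantumFields.BalabanUV.Beta.FP.PerfectPolarizationReflection (axisReflectionCovariant_lincomb)
open Summit.QuantumFields.BalabanUV.Beta.FP.SliceKcovStraight (axisReflectionCovariant_flip_hessKer_sliceTotal_straight)
open Summit.QuantumFields.BalabanUV.Beta.FP.GhostBiTableReflection (axisReflectionCovariant_flip_hessKer_ghostX)
open Summit.QuantumFields.BalabanUV.Beta.FP.LegShiftDictionary (PiBF_legShift)
open Summit.QuantumFields.BalabanUV.Beta.FP.PerfectPolarization (PiBF)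
open KernelReflection (LegMap)
open B6BondElimination (unitVec)
open ExpKernelCalculus (BiLoc)

variable (wg wgh cV c : ℝ) (N L : ℕ) [NeZero L] {S₃ : Fin 4 → Site 4 → MKer 4 (Fib 3)} {S₄ : Fin 4 → Site 4 → Fin 4 → Site 4 → MKer 4 (Fib 3)}
  {Rm : Fin 4 → Fin 4 → Site 4 → Fin 4 → Site 4 → MKer 4 (Fib 3)}

/-- [our object] **THE (Kcov) LETTER OF THE STRAIGHT BF POLARIZATION** — gluon sector at `Pkerˢˢ` over the total data (R13, displayed `S∞`-share laws), ghost sector at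
`(cV • ghCur, diagExt (c • ghX))` (leaf-01, unconditional), weights `wg`, `wgh` arbitrary:
`AxisReflectionCovariant (flipK (fun μ ν z => wg·hessKer Pkerˢˢ (S₃ + sliceA 3) (S₄ + sliceW 3) μ ν z − wgh·hessKer G0ker (cV • ghCur) (diagExt (c • ghX)) μ ν z))`. -/
theorem axisReflectionCovariant_flipK_straightBF
    (hS₃L : ∀ κ u, Loc (S₃ κ u)) (hS₄L : ∀ κ u κ' u', Loc (S₄ κ u κ' u'))
    (hS₃t : ∀ (κ : Fin 4) (u t : Site 4), S₃ κ (u + t) = shiftK (-t) (S₃ κ u))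
    (hS₄t : ∀ (κ : Fin 4) (u : Site 4) (κ' : Fin 4) (u' t : Site 4), S₄ κ (u + t) κ' (u' + t) = shiftK (-t) (S₄ κ u κ' u'))
    (hS₃ : ∀ (α κ : Fin 4) (u : Site 4), S₃ κ (bref α κ u) = reflSign α κ • refK (Φ N α)
      (S₃ κ u + conjV ((fun x z a b => MF z x a b) - ddKer) (diagK (fun y c => -ctGen 3 α L κ u y c))))
    (hS₄ : ∀ (α κ : Fin 4) (u : Site 4) (κ' : Fin 4) (u' : Site 4), S₄ κ (bref α κ u) κ' (bref α κ' u') = (reflSign α κ * reflSign α κ') • refK (Φ N α)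
      (S₄ κ u κ' u' + conjW ((fun x z a b => MF z x a b) - ddKer) (S₃ κ u) (S₃ κ' u') (diagK (fun y c => -ctGen 3 α L κ u y c))
        (diagK (fun y c => -ctGen 3 α L κ' u' y c)) (diagK (fun y c => ctGen 3 α L κ u y c * ctGen 3 α L κ' u' y c)) + Rm α κ u κ' u'))
    (hRmL : ∀ α κ u κ' u', Loc (Rm α κ u κ' u')) (hRm0 : ∀ α κ u κ' u', tadpole (fun x z a b => Pker z x a b) (Rm α κ u κ' u') = 0) :
    AxisReflectionCovariant (flipK (fun μ ν z =>
      wg * hessKer (fun x z a b => Pker z x a b) (fun κ u => S₃ κ u + sliceA 3 κ u) (fun κ u κ' u' => S₄ κ u κ' u' + sliceW 3 κ u κ' u') μ ν z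
        - wgh * hessKer G0ker (fun μ y => cV • ghCur μ y) (diagExt (fun κ u => c • ghX κ u)) μ ν z)) := by
  have h1 := axisReflectionCovariant_flip_hessKer_sliceTotal_straight N L hS₃L hS₄L hS₃t hS₄t hS₃ hS₄ hRmL hRm0
  have h2 := axisReflectionCovariant_flip_hessKer_ghostX cV c
  have h := axisReflectionCovariant_lincomb h1 h2 wg wgh
  intro α μ ν z
  have h' := h α μ ν z
  simp only [flipK_apply] at h' ⊢
  exact h'

/-- [our object] **THE SAME AT THE ENDs' LITERAL GHOST DATA `(ghCur, diagExt (−ghX))`** (`cV = 1`, `c = −1`, the `1 •` removed) — EXACTLY the `hKcov` shape the owner's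
`RoadLeftLiteralStraight` displays (R-FP-42 (4e), CLAIMS l.30563). -/
theorem axisReflectionCovariant_flipK_straightBF_end
    (hS₃L : ∀ κ u, Loc (S₃ κ u)) (hS₄L : ∀ κ u κ' u', Loc (S₄ κ u κ' u'))
    (hS₃t : ∀ (κ : Fin 4) (u t : Site 4), S₃ κ (u + t) = shiftK (-t) (S₃ κ u))
    (hS₄t : ∀ (κ : Fin 4) (u : Site 4) (κ' : Fin 4) (u' t : Site 4), S₄ κ (u + t) κ' (u' + t) = shiftK (-t) (S₄ κ u κ' u'))
    (hS₃ : ∀ (α κ : Fin 4) (u : Site 4), S₃ κ (bref α κ u) = reflSign α κ • refK (Φ N α)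
      (S₃ κ u + conjV ((fun x z a b => MF z x a b) - ddKer) (diagK (fun y c => -ctGen 3 α L κ u y c))))
    (hS₄ : ∀ (α κ : Fin 4) (u : Site 4) (κ' : Fin 4) (u' : Site 4), S₄ κ (bref α κ u) κ' (bref α κ' u') = (reflSign α κ * reflSign α κ') • refK (Φ N α)
      (S₄ κ u κ' u' + conjW ((fun x z a b => MF z x a b) - ddKer) (S₃ κ u) (S₃ κ' u') (diagK (fun y c => -ctGen 3 α L κ u y c))
        (diagK (fun y c => -ctGen 3 α L κ' u' y c)) (diagK (fun y c => ctGen 3 α L κ u y c * ctGen 3 α L κ' u' y c)) + Rm α κ u κ' u'))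
    (hRmL : ∀ α κ u κ' u', Loc (Rm α κ u κ' u')) (hRm0 : ∀ α κ u κ' u', tadpole (fun x z a b => Pker z x a b) (Rm α κ u κ' u') = 0) :
    AxisReflectionCovariant (flipK (fun μ ν z =>
      wg * hessKer (fun x z a b => Pker z x a b) (fun κ u => S₃ κ u + sliceA 3 κ u) (fun κ u κ' u' => S₄ κ u κ' u' + sliceW 3 κ u κ' u') μ ν z
        - wgh * hessKer G0ker ghCur (diagExt (fun κ u => (-1 : ℝ) • ghX κ u)) μ ν z)) := by
  have h := axisReflectionCovariant_flipK_straightBF wg wgh 1 (-1) N L hS₃L hS₄L hS₃t hS₄t hS₃ hS₄ hRmL hRm0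
  have e : (fun (μ : Fin 4) (y : Site 4) => (1 : ℝ) • ghCur μ y) = ghCur := by
    funext μ y; exact one_smul _ _
  rw [e] at h
  exact h

/-! ## §2 The same letter at `PiBF` as typed, over the relabelled gluon data (R-FP-42's dictionary) -/

/-- [our object] **THE `hKcov` BINDER OF THE LITERAL ENDs FOR THE RELABELLED STRAIGHT DATA**: with the leg-shift relabelling `Ψ` of `LegShiftDictionary.exists_legShift`
(`x ↦ x − e_α` on field legs, signs `+1`) and UNIFORM bi-localisation of the total gluon data (the ENDs' own `hV`∕`hW` letters), §1 + the owner's `PiBF_legShift` give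
`AxisReflectionCovariant (flipK (PiBF wg wgh (Ψ·(S₃ + sliceA 3)) (Ψ·(S₄ + sliceW 3)) (cV • ghCur) (diagExt (c • ghX))))`. -/
theorem axisReflectionCovariant_flipK_PiBF_legShift (Ψ : LegMap 4 (Fib 3))
    (hr : ∀ (α : Fin 4) (x : Site 4), Ψ.r (Sum.inl α) x = x - unitVec α) (hs : ∀ a : Fib 3, Ψ.s a = 1)
    {Cv Cw δ : ℝ} (hδ : 0 < δ)
    (hVt : ∀ (μ : Fin 4) (y : Site 4), BiLoc (S₃ μ y + sliceA 3 μ y) y y Cv δ)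
    (hWt : ∀ (μ : Fin 4) (y : Site 4) (ν : Fin 4) (y' : Site 4), BiLoc (S₄ μ y ν y' + sliceW 3 μ y ν y') y y' Cw δ)
    (hS₃L : ∀ κ u, Loc (S₃ κ u)) (hS₄L : ∀ κ u κ' u', Loc (S₄ κ u κ' u'))
    (hS₃t : ∀ (κ : Fin 4) (u t : Site 4), S₃ κ (u + t) = shiftK (-t) (S₃ κ u))
    (hS₄t : ∀ (κ : Fin 4) (u : Site 4) (κ' : Fin 4) (u' t : Site 4), S₄ κ (u + t) κ' (u' + t) = shiftK (-t) (S₄ κ u κ' u'))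
    (hS₃ : ∀ (α κ : Fin 4) (u : Site 4), S₃ κ (bref α κ u) = reflSign α κ • refK (Φ N α)
      (S₃ κ u + conjV ((fun x z a b => MF z x a b) - ddKer) (diagK (fun y c => -ctGen 3 α L κ u y c))))
    (hS₄ : ∀ (α κ : Fin 4) (u : Site 4) (κ' : Fin 4) (u' : Site 4), S₄ κ (bref α κ u) κ' (bref α κ' u') = (reflSign α κ * reflSign α κ') • refK (Φ N α)
      (S₄ κ u κ' u' + conjW ((fun x z a b => MF z x a b) - ddKer) (S₃ κ u) (S₃ κ' u') (diagK (fun y c => -ctGen 3 α L κ u y c))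
        (diagK (fun y c => -ctGen 3 α L κ' u' y c)) (diagK (fun y c => ctGen 3 α L κ u y c * ctGen 3 α L κ' u' y c)) + Rm α κ u κ' u'))
    (hRmL : ∀ α κ u κ' u', Loc (Rm α κ u κ' u')) (hRm0 : ∀ α κ u κ' u', tadpole (fun x z a b => Pker z x a b) (Rm α κ u κ' u') = 0) :
    AxisReflectionCovariant (flipK (PiBF wg wgh
      (fun μ y => refK Ψ ((fun κ u => S₃ κ u + sliceA 3 κ u) μ y))
      (fun μ y ν y' => refK Ψ ((fun κ u κ' u' => S₄ κ u κ' u' + sliceW 3 κ u κ' u') μ y ν y'))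
      (fun μ y => cV • ghCur μ y) (diagExt (fun κ u => c • ghX κ u)))) := by
  have h := axisReflectionCovariant_flipK_straightBF wg wgh cV c N L hS₃L hS₄L hS₃t hS₄t hS₃ hS₄ hRmL hRm0
  have e : PiBF wg wgh (fun μ y => refK Ψ ((fun κ u => S₃ κ u + sliceA 3 κ u) μ y))
      (fun μ y ν y' => refK Ψ ((fun κ u κ' u' => S₄ κ u κ' u' + sliceW 3 κ u κ' u') μ y ν y'))
      (fun μ y => cV • ghCur μ y) (diagExt (fun κ u => c • ghX κ u))
      = fun μ ν z => wg * hessKer (fun x z a b => Pker z x a b) (fun κ u => S₃ κ u + sliceA 3 κ u)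
          (fun κ u κ' u' => S₄ κ u κ' u' + sliceW 3 κ u κ' u') μ ν z
        - wgh * hessKer G0ker (fun μ y => cV • ghCur μ y) (diagExt (fun κ u => c • ghX κ u)) μ ν z := by
    funext μ ν z
    exact PiBF_legShift Ψ hr hs wg wgh (V := fun κ u => S₃ κ u + sliceA 3 κ u) (W := fun κ u κ' u' => S₄ κ u κ' u' + sliceW 3 κ u κ' u')
      hδ hVt hWt _ _ μ ν z
  rw [e]
  exact h

end Summit.QuantumFields.BalabanUV.Beta.FP.StraightPolarizationKcov

end
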